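import Summits.AnomalousDissipation.AnomalousDissipation.Theorems.MomentParityCubicParityLoudBalancedMenuAverages
import Summits.AnomalousDissipation.AnomalousDissipation.Theorems.MomentParityCubicParityLoudBalancedMenuModes
import Summits.AnomalousDissipation.AnomalousDissipation.Theorems.MomentParityCubicParityLoudBalancedMenuPackets

/-!
# The pieces of the balanced menu: packet pieces and sea pieces, with their weights

Helper file for stub S5 (`stub_balancedMenu`) of the line `farkas-split-menu` of crux
`MomentParity.CubicParityLoud` (stmt-AnomalousDissipation-11465). For the two kinds of pieces entering
the random-sign atom cloud this file records conjugate symmetry, transversality and the exact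
ENERGY `E(c) = ∑_κ ‖c κ‖²`, ENSTROPHY `Z(c) = ∑_κ |κ|²‖c κ‖²` and HELICITY
`Hel(c) = ∑_κ Re⟪c κ, -(4π²|κ|² • curlCoeff c κ)⟫` weights:

* a PACKET PIECE `(δ_k (φx) + δ_{-k} \overline{φx}) + (δ_{k+q} (φy) + δ_{-(k+q)} \overline{φy})`
  (`|φ| = 1`, `x ⊥ k`, `y ⊥ k, q`, `x, y` linearly polarised, the four frequencies distinct):
  `E = 2‖x‖² + 2‖y‖²`, `Z = 2|k|²‖x‖² + 2|k+q|²‖y‖²`, `Hel = 0`;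
* a SEA PIECE `δ_{k_s} (A h_σ) + δ_{-k_s} \overline{A h_σ}`, `k_s = (K,0,0)`, `h_σ = (0, 1, σ i)`,
  `σ = ±1`: zero self-stress, `E = 4A²`, `Z = 4K²A²`, `Hel = -σ 32π³K³A²`;
* the RESIDUAL FORCE bookkeeping: conjugate symmetry of real even multiples of a conjugate-symmetric
  family (`T(κ) = f̂(κ) - 4π²ν|κ|² m̂(κ)` is conjugate symmetric), everywhere-transversality of a mode
  pair, additivity of mode pairs in the amplitude, the RESUMMATION
  `∑_{q∈S} (δ_q (T(q)/2) + δ_{-q} \overline{T(q)/2})(κ) = T(κ)` on a symmetric `S ∋ κ` (each momentum is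
  served half by the packet at `q` and half by the conjugate of the packet at `-q`), the bound
  `‖a - s • b‖² ≤ 2‖a‖² + 2r²‖b‖²` (`|s| ≤ r`), and the weighted mass of a mode pair under an even weight.
-/

noncomputable section

namespace Summit.AnomalousDissipation.AnomalousDissipation.Theorems.MomentParityCubicParityLoud

open Finset Complex
open scoped ComplexConjugate
open Literature.Analysis.FunctionSpaces Literature.Analysis.FluidPDE
open Summit.AnomalousDissipation.AnomalousDissipation.Theorems.MomentParityQuarticGate

set_option linter.dupNamespace false

/-! ## Linearly polarised pairs carry no helicity -/

section Polarised

/-- **A linearly polarised mode pair has zero helicity weight**: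
`∑_{κ∈S} Re⟪P κ, -(c κ • curlCoeff P κ)⟫ = 0` for `P = δ_k (a v) + δ_{-k} (ā v)`, `v` real (the curl
symbol is written through the value `P κ`, to which it only refers). [folklore] -/
theorem helicity_pair_polarised {S : Finset (Fin 3 → ℤ)} {k : Fin 3 → ℤ} (hk0 : k ≠ 0) (hk : k ∈ S) (hnk : -k ∈ S)
    (a : ℂ) (v : EuclideanSpace ℝ (Fin 3)) (c : (Fin 3 → ℤ) → ℂ) :
    ∑ κ ∈ S, (inner ℂ ((Pi.single k (a • EuclideanSpace.complexify v) +
        Pi.single (-k) (EuclideanSpace.conjVec (a • EuclideanSpace.complexify v)) :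
          (Fin 3 → ℤ) → EuclideanSpace ℂ (Fin 3)) κ)
      (-(c κ • IntermittentBeltrami.curlCoeff (fun _ => (Pi.single k (a • EuclideanSpace.complexify v) +
        Pi.single (-k) (EuclideanSpace.conjVec (a • EuclideanSpace.complexify v)) :
          (Fin 3 → ℤ) → EuclideanSpace ℂ (Fin 3)) κ) κ))).re = 0 := by
  have h := sum_apply_pair hk0 hk hnk
    (fun κ' (z : EuclideanSpace ℂ (Fin 3)) => (inner ℂ z (-(c κ' • IntermittentBeltrami.curlCoeff (fun _ => z) κ'))).re)
    (fun κ => by simp only [inner_zero_left, Complex.zero_re]) (a • EuclideanSpace.complexify v)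
  refine h.trans ?_
  rw [inner_neg_right, inner_smul_right, inner_curlCoeff_eq_zero_of_parallel (b := a) rfl, mul_zero, neg_zero,
    Complex.zero_re, zero_add, EuclideanSpace.conjVec_smul, EuclideanSpace.conjVec_complexify, inner_neg_right,
    inner_smul_right, inner_curlCoeff_eq_zero_of_parallel (b := conj a) rfl, mul_zero, neg_zero, Complex.zero_re]

end Polarised

/-! ## Packet pieces -/

section PacketPiece

variable {S : Finset (Fin 3 → ℤ)} {k q : Fin 3 → ℤ} {x y : EuclideanSpace ℂ (Fin 3)} {φ : ℂ}

/-- **Conjugate symmetry of a packet piece.** [folklore] -/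
theorem isConjSymm_packetPiece (k q : Fin 3 → ℤ) (x y : EuclideanSpace ℂ (Fin 3)) (φ : ℂ) :
    Torus.IsConjSymm ((Pi.single k (φ • x) + Pi.single (-k) (EuclideanSpace.conjVec (φ • x))) +
      (Pi.single (k + q) (φ • y) + Pi.single (-(k + q)) (EuclideanSpace.conjVec (φ • y))) :
        (Fin 3 → ℤ) → EuclideanSpace ℂ (Fin 3)) :=
  (isConjSymm_pair k (φ • x)).add (isConjSymm_pair (k + q) (φ • y))

/-- **Transversality of a packet piece** (`x ⊥ k`, `y ⊥ k`, `y ⊥ q`). [folklore] -/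
theorem isTransversal_packetPiece (S : Finset (Fin 3 → ℤ)) (φ : ℂ)
    (hxk : ∑ j, (k j : ℂ) * x j = 0) (hyk : ∑ j, (k j : ℂ) * y j = 0) (hyq : ∑ j, (q j : ℂ) * y j = 0) :
    Torus.IsTransversal S ((Pi.single k (φ • x) + Pi.single (-k) (EuclideanSpace.conjVec (φ • x))) +
      (Pi.single (k + q) (φ • y) + Pi.single (-(k + q)) (EuclideanSpace.conjVec (φ • y))) :
        (Fin 3 → ℤ) → EuclideanSpace ℂ (Fin 3)) :=
  isTransversal_add S (isTransversal_pair S (sum_mul_smul_eq_zero φ hxk))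
    (isTransversal_pair S (k := k + q) (sum_mul_smul_eq_zero φ (sum_add_mul_eq_zero hyk hyq)))

/-- **Energy of a packet piece**: `∑_κ ‖Pk κ‖² = 2‖x‖² + 2‖y‖²` (`|φ| = 1`). [folklore] -/
theorem energy_packetPiece (hk : k ∈ S) (hkq : k + q ∈ S) (hnk : -k ∈ S) (hnkq : -(k + q) ∈ S)
    (hk0 : k ≠ 0) (hkq0 : k + q ≠ 0) (hq : q ≠ 0) (h2kq : 2 • k + q ≠ 0) (hφ : ‖φ‖ = 1) :
    ∑ κ ∈ S, ‖((Pi.single k (φ • x) + Pi.single (-k) (EuclideanSpace.conjVec (φ • x))) +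
      (Pi.single (k + q) (φ • y) + Pi.single (-(k + q)) (EuclideanSpace.conjVec (φ • y))) :
        (Fin 3 → ℤ) → EuclideanSpace ℂ (Fin 3)) κ‖ ^ 2 = 2 * ‖x‖ ^ 2 + 2 * ‖y‖ ^ 2 := by
  rw [sum_apply_add_of_disjoint S (fun _ z => ‖z‖ ^ 2) (fun _ => by simp) (pair_disjoint_pair hq h2kq (φ • x) (φ • y)),
    sum_norm_sq_pair hk0 hk hnk, sum_norm_sq_pair hkq0 hkq hnkq, norm_smul, norm_smul, hφ, one_mul, one_mul]

/-- **Enstrophy of a packet piece**: `∑_κ |κ|²‖Pk κ‖² = 2|k|²‖x‖² + 2|k+q|²‖y‖²` (`|φ| = 1`). [folklore] -/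
theorem enstrophy_packetPiece (hk : k ∈ S) (hkq : k + q ∈ S) (hnk : -k ∈ S) (hnkq : -(k + q) ∈ S)
    (hk0 : k ≠ 0) (hkq0 : k + q ≠ 0) (hq : q ≠ 0) (h2kq : 2 • k + q ≠ 0) (hφ : ‖φ‖ = 1) :
    ∑ κ ∈ S, Torus.freqNormSq κ * ‖((Pi.single k (φ • x) + Pi.single (-k) (EuclideanSpace.conjVec (φ • x))) +
      (Pi.single (k + q) (φ • y) + Pi.single (-(k + q)) (EuclideanSpace.conjVec (φ • y))) :
        (Fin 3 → ℤ) → EuclideanSpace ℂ (Fin 3)) κ‖ ^ 2 =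
      2 * (Torus.freqNormSq k * ‖x‖ ^ 2) + 2 * (Torus.freqNormSq (k + q) * ‖y‖ ^ 2) := by
  rw [sum_apply_add_of_disjoint S (fun κ z => Torus.freqNormSq κ * ‖z‖ ^ 2) (fun _ => by simp)
      (pair_disjoint_pair hq h2kq (φ • x) (φ • y)),
    sum_freqNormSq_mul_norm_sq_pair hk0 hk hnk, sum_freqNormSq_mul_norm_sq_pair hkq0 hkq hnkq, norm_smul, norm_smul,
    hφ, one_mul, one_mul]

/-- **A packet piece with linearly polarised amplitudes carries no helicity.** [folklore] -/
theorem helicity_packetPiece (hk : k ∈ S) (hkq : k + q ∈ S) (hnk : -k ∈ S) (hnkq : -(k + q) ∈ S)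
    (hk0 : k ≠ 0) (hkq0 : k + q ≠ 0) (hq : q ≠ 0) (h2kq : 2 • k + q ≠ 0)
    (hx : ∃ (a : ℂ) (v : EuclideanSpace ℝ (Fin 3)), x = a • EuclideanSpace.complexify v)
    (hy : ∃ (a : ℂ) (v : EuclideanSpace ℝ (Fin 3)), y = a • EuclideanSpace.complexify v) :
    ∑ κ ∈ S, (inner ℂ (((Pi.single k (φ • x) + Pi.single (-k) (EuclideanSpace.conjVec (φ • x))) +
      (Pi.single (k + q) (φ • y) + Pi.single (-(k + q)) (EuclideanSpace.conjVec (φ • y))) :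
        (Fin 3 → ℤ) → EuclideanSpace ℂ (Fin 3)) κ)
      (-((((4 * Real.pi ^ 2 * Torus.freqNormSq κ : ℝ) : ℂ)) •
        IntermittentBeltrami.curlCoeff ((Pi.single k (φ • x) + Pi.single (-k) (EuclideanSpace.conjVec (φ • x))) +
          (Pi.single (k + q) (φ • y) + Pi.single (-(k + q)) (EuclideanSpace.conjVec (φ • y))) :
            (Fin 3 → ℤ) → EuclideanSpace ℂ (Fin 3)) κ))).re = 0 := by
  obtain ⟨a, v, rfl⟩ := hx
  obtain ⟨b, w, rfl⟩ := hy
  rw [smul_smul, smul_smul]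
  refine (sum_apply_add_of_disjoint S
    (fun κ' (z : EuclideanSpace ℂ (Fin 3)) => (inner ℂ z (-((((4 * Real.pi ^ 2 * Torus.freqNormSq κ' : ℝ) : ℂ)) •
      IntermittentBeltrami.curlCoeff (fun _ => z) κ'))).re)
    (fun _ => by simp only [inner_zero_left, Complex.zero_re])
    (pair_disjoint_pair hq h2kq ((φ * a) • EuclideanSpace.complexify v) ((φ * b) • EuclideanSpace.complexify w))).trans ?_
  rw [helicity_pair_polarised hk0 hk hnk, helicity_pair_polarised hkq0 hkq hnkq, add_zero]

end PacketPiece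

/-! ## Sea pieces -/

section SeaPiece

/-- The helical polarisation factor has modulus one: `‖σ i‖ = 1` for `σ = ±1`. [folklore] -/
theorem norm_sign_mul_I {σ : ℝ} (hσ : σ = 1 ∨ σ = -1) : ‖((σ : ℝ) : ℂ) * I‖ = 1 := by
  rcases hσ with h | h <;> simp [h]

/-- **Conjugate symmetry of a sea piece.** [folklore] -/
theorem isConjSymm_seaPiece (K : ℕ) (A : ℝ) (σ : ℝ) :
    Torus.IsConjSymm (Pi.single (![(K : ℤ), 0, 0] : Fin 3 → ℤ) ((A : ℂ) • !₂[(0 : ℂ), 1, σ * I]) +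
      Pi.single (-(![(K : ℤ), 0, 0] : Fin 3 → ℤ)) (EuclideanSpace.conjVec ((A : ℂ) • !₂[(0 : ℂ), 1, σ * I])) :
        (Fin 3 → ℤ) → EuclideanSpace ℂ (Fin 3)) :=
  isConjSymm_pair _ _

/-- **Transversality of a sea piece.** [folklore] -/
theorem isTransversal_seaPiece (S : Finset (Fin 3 → ℤ)) (K : ℕ) (A : ℝ) (σ : ℝ) :
    Torus.IsTransversal S (Pi.single (![(K : ℤ), 0, 0] : Fin 3 → ℤ) ((A : ℂ) • !₂[(0 : ℂ), 1, σ * I]) +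
      Pi.single (-(![(K : ℤ), 0, 0] : Fin 3 → ℤ)) (EuclideanSpace.conjVec ((A : ℂ) • !₂[(0 : ℂ), 1, σ * I])) :
        (Fin 3 → ℤ) → EuclideanSpace ℂ (Fin 3)) :=
  isTransversal_pair S (shell_transversal K A _)

/-- **A sea piece has zero self-stress.** [folklore] -/
theorem convectionCoeff_seaPiece (S : Finset (Fin 3 → ℤ)) (K : ℕ) (A : ℝ) (σ : ℝ) :
    Torus.convectionCoeff S (Pi.single (![(K : ℤ), 0, 0] : Fin 3 → ℤ) ((A : ℂ) • !₂[(0 : ℂ), 1, σ * I]) +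
        Pi.single (-(![(K : ℤ), 0, 0] : Fin 3 → ℤ)) (EuclideanSpace.conjVec ((A : ℂ) • !₂[(0 : ℂ), 1, σ * I])))
      (Pi.single (![(K : ℤ), 0, 0] : Fin 3 → ℤ) ((A : ℂ) • !₂[(0 : ℂ), 1, σ * I]) +
        Pi.single (-(![(K : ℤ), 0, 0] : Fin 3 → ℤ)) (EuclideanSpace.conjVec ((A : ℂ) • !₂[(0 : ℂ), 1, σ * I]))) = 0 :=
  convectionCoeff_pair_self S (shell_transversal K A _)

/-- **Energy of a sea piece**: `4A²` (`σ = ±1`, `1 ≤ K ≤ N`, punctured ball of radius `N`). [folklore] -/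
theorem energy_seaPiece {K N : ℕ} (hK : 1 ≤ K) (hKN : K ≤ N) (A : ℝ) {σ : ℝ} (hσ : σ = 1 ∨ σ = -1) :
    ∑ κ ∈ (Torus.freqBall N).erase 0, ‖(Pi.single (![(K : ℤ), 0, 0] : Fin 3 → ℤ) ((A : ℂ) • !₂[(0 : ℂ), 1, σ * I]) +
      Pi.single (-(![(K : ℤ), 0, 0] : Fin 3 → ℤ)) (EuclideanSpace.conjVec ((A : ℂ) • !₂[(0 : ℂ), 1, σ * I])) :
        (Fin 3 → ℤ) → EuclideanSpace ℂ (Fin 3)) κ‖ ^ 2 = 4 * A ^ 2 := by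
  rw [sum_norm_sq_pair (shell_ne_zero hK) (shell_mem hK hKN) (neg_shell_mem hK hKN),
    norm_sq_helical A (norm_sign_mul_I hσ)]
  ring

/-- **Enstrophy of a sea piece**: `4K²A²`. [folklore] -/
theorem enstrophy_seaPiece {K N : ℕ} (hK : 1 ≤ K) (hKN : K ≤ N) (A : ℝ) {σ : ℝ} (hσ : σ = 1 ∨ σ = -1) :
    ∑ κ ∈ (Torus.freqBall N).erase 0, Torus.freqNormSq κ *
      ‖(Pi.single (![(K : ℤ), 0, 0] : Fin 3 → ℤ) ((A : ℂ) • !₂[(0 : ℂ), 1, σ * I]) +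
        Pi.single (-(![(K : ℤ), 0, 0] : Fin 3 → ℤ)) (EuclideanSpace.conjVec ((A : ℂ) • !₂[(0 : ℂ), 1, σ * I])) :
          (Fin 3 → ℤ) → EuclideanSpace ℂ (Fin 3)) κ‖ ^ 2 = 4 * (K : ℝ) ^ 2 * A ^ 2 := by
  rw [sum_freqNormSq_mul_norm_sq_pair (shell_ne_zero hK) (shell_mem hK hKN) (neg_shell_mem hK hKN),
    norm_sq_helical A (norm_sign_mul_I hσ), freqNormSq_shell]
  ring

/-- **Helicity of a sea piece**: `-σ 32π³K³A²`, in the form of the atom helicity row. [folklore] -/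
theorem helicity_seaPiece {K N : ℕ} (hK : 1 ≤ K) (hKN : K ≤ N) (A σ : ℝ) :
    ∑ κ ∈ (Torus.freqBall N).erase 0, (inner ℂ
      ((Pi.single (![(K : ℤ), 0, 0] : Fin 3 → ℤ) ((A : ℂ) • !₂[(0 : ℂ), 1, σ * I]) +
        Pi.single (-(![(K : ℤ), 0, 0] : Fin 3 → ℤ)) (EuclideanSpace.conjVec ((A : ℂ) • !₂[(0 : ℂ), 1, σ * I])) :
          (Fin 3 → ℤ) → EuclideanSpace ℂ (Fin 3)) κ)
      (-((((4 * Real.pi ^ 2 * Torus.freqNormSq κ : ℝ) : ℂ)) • IntermittentBeltrami.curlCoeff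
        (Pi.single (![(K : ℤ), 0, 0] : Fin 3 → ℤ) ((A : ℂ) • !₂[(0 : ℂ), 1, σ * I]) +
          Pi.single (-(![(K : ℤ), 0, 0] : Fin 3 → ℤ)) (EuclideanSpace.conjVec ((A : ℂ) • !₂[(0 : ℂ), 1, σ * I])) :
            (Fin 3 → ℤ) → EuclideanSpace ℂ (Fin 3)) κ))).re =
      -σ * (32 * Real.pi ^ 3 * (K : ℝ) ^ 3 * A ^ 2) := by
  simp_rw [← neg_smul]
  exact helicity_helical_pair hK (shell_mem hK hKN) (neg_shell_mem hK hKN) A σ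

end SeaPiece

/-! ## The residual force and its resummation -/

section Residual


/-- **Real even multiples of a conjugate-symmetric family are conjugate symmetric.** [folklore] -/
theorem isConjSymm_smul_of_even {c : (Fin 3 → ℤ) → EuclideanSpace ℂ (Fin 3)} (hc : Torus.IsConjSymm c)
    (r : (Fin 3 → ℤ) → ℝ) (hr : ∀ k, r (-k) = r k) (a : ℝ) :
    Torus.IsConjSymm (fun k => (((r k : ℝ) : ℂ) * (a : ℂ)) • c k) := fun k => by
  simp only [hc k, hr k, EuclideanSpace.conjVec_smul, map_mul, Complex.conj_ofReal]

/-- The enstrophy multiplier `4π²|k|²` is even. [folklore] -/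
theorem freqWeight_even (k : Fin 3 → ℤ) :
    4 * Real.pi ^ 2 * Torus.freqNormSq (-k) = 4 * Real.pi ^ 2 * Torus.freqNormSq k := by
  rw [Torus.freqNormSq_neg]

/-- **A mode pair with `k · w = 0` is transversal at every frequency.** [folklore] -/
theorem sum_mul_pair_apply_eq_zero {k : Fin 3 → ℤ} {w : EuclideanSpace ℂ (Fin 3)} (hkw : ∑ j, (k j : ℂ) * w j = 0)
    (κ : Fin 3 → ℤ) :
    ∑ j, (κ j : ℂ) * (Pi.single k w + Pi.single (-k) (EuclideanSpace.conjVec w) :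
      (Fin 3 → ℤ) → EuclideanSpace ℂ (Fin 3)) κ j = 0 :=
  isTransversal_pair {κ} hkw κ (Finset.mem_singleton_self κ)

/-- Scalar multiples of a pointwise transversal vector are transversal. [folklore] -/
theorem sum_mul_smul_apply_eq_zero {κ : Fin 3 → ℤ} {z : EuclideanSpace ℂ (Fin 3)} (a : ℂ)
    (h : ∑ j, (κ j : ℂ) * z j = 0) : ∑ j, (κ j : ℂ) * (a • z) j = 0 := by
  simp only [PiLp.smul_apply, smul_eq_mul]
  calc ∑ j, (κ j : ℂ) * (a * z j) = a * ∑ j, (κ j : ℂ) * z j := by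
        rw [Finset.mul_sum]; exact Finset.sum_congr rfl fun j _ => by ring
    _ = 0 := by rw [h, mul_zero]

/-- Differences of pointwise transversal vectors are transversal. [folklore] -/
theorem sum_mul_sub_eq_zero {κ : Fin 3 → ℤ} {z z' : EuclideanSpace ℂ (Fin 3)}
    (h : ∑ j, (κ j : ℂ) * z j = 0) (h' : ∑ j, (κ j : ℂ) * z' j = 0) : ∑ j, (κ j : ℂ) * (z - z') j = 0 := by
  simp only [PiLp.sub_apply, mul_sub, Finset.sum_sub_distrib, h, h', sub_zero]

/-- **Mode pairs are additive in the amplitude.** [folklore] -/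
theorem pair_add_pair (k : Fin 3 → ℤ) (w w' : EuclideanSpace ℂ (Fin 3)) :
    ((Pi.single k w + Pi.single (-k) (EuclideanSpace.conjVec w)) +
        (Pi.single k w' + Pi.single (-k) (EuclideanSpace.conjVec w')) : (Fin 3 → ℤ) → EuclideanSpace ℂ (Fin 3)) =
      Pi.single k (w + w') + Pi.single (-k) (EuclideanSpace.conjVec (w + w')) := by
  rw [EuclideanSpace.conjVec_add, Pi.single_add, Pi.single_add]
  abel

/-- **Resummation of half-served mode pairs**: on a symmetric frequency set `S ∋ κ` and for a
conjugate-symmetric `T`, `∑_{q∈S} (δ_q (T q / 2) + δ_{-q} \overline{T q / 2})(κ) = T κ`. [folklore] -/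
theorem sum_pair_half_apply {S : Finset (Fin 3 → ℤ)} (hS : ∀ k ∈ S, -k ∈ S)
    {T : (Fin 3 → ℤ) → EuclideanSpace ℂ (Fin 3)} (hT : Torus.IsConjSymm T) {κ : Fin 3 → ℤ} (hκ : κ ∈ S) :
    ∑ q ∈ S, (Pi.single q ((2⁻¹ : ℂ) • T q) + Pi.single (-q) (EuclideanSpace.conjVec ((2⁻¹ : ℂ) • T q)) :
      (Fin 3 → ℤ) → EuclideanSpace ℂ (Fin 3)) κ = T κ := by
  simp_rw [pair_apply]
  rw [Finset.sum_add_distrib, Finset.sum_ite_eq, if_pos hκ]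
  have hcond : ∀ q : Fin 3 → ℤ, (κ = -q) = (-κ = q) := fun q =>
    propext ⟨fun h => by rw [h, neg_neg], fun h => by rw [← h, neg_neg]⟩
  simp_rw [hcond]
  rw [Finset.sum_ite_eq, if_pos (hS κ hκ), EuclideanSpace.conjVec_smul, hT κ, EuclideanSpace.conjVec_conjVec,
    map_inv₀, map_ofNat, ← add_smul]
  norm_num

/-- `‖a - s • b‖² ≤ 2‖a‖² + 2 r² ‖b‖²` whenever `‖s‖ ≤ r`. [folklore] -/
theorem norm_sq_sub_smul_le {E : Type*} [SeminormedAddCommGroup E] [NormedSpace ℂ E] (a b : E) {s : ℂ} {r : ℝ}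
    (hs : ‖s‖ ≤ r) : ‖a - s • b‖ ^ 2 ≤ 2 * ‖a‖ ^ 2 + 2 * (r ^ 2 * ‖b‖ ^ 2) := by
  have h1 : ‖a - s • b‖ ≤ ‖a‖ + ‖s‖ * ‖b‖ := (norm_sub_le _ _).trans (by rw [norm_smul])
  have h2 : ‖s‖ * ‖b‖ ≤ r * ‖b‖ := mul_le_mul_of_nonneg_right hs (norm_nonneg _)
  have h3 : ‖a - s • b‖ ≤ ‖a‖ + r * ‖b‖ := h1.trans (by linarith)
  have h4 := mul_self_le_mul_self (norm_nonneg _) h3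
  nlinarith [sq_nonneg (‖a‖ - r * ‖b‖)]

/-- **Weighted mass of a mode pair under an even weight**: `∑_{κ∈S} W κ ‖P κ‖² = 2 W k ‖w‖²`. [folklore] -/
theorem sum_weight_mul_norm_sq_pair {S : Finset (Fin 3 → ℤ)} {k : Fin 3 → ℤ} (hk0 : k ≠ 0) (hk : k ∈ S)
    (hnk : -k ∈ S) (W : (Fin 3 → ℤ) → ℝ) (hW : W (-k) = W k) (w : EuclideanSpace ℂ (Fin 3)) :
    ∑ κ ∈ S, W κ * ‖(Pi.single k w + Pi.single (-k) (EuclideanSpace.conjVec w) :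
      (Fin 3 → ℤ) → EuclideanSpace ℂ (Fin 3)) κ‖ ^ 2 = 2 * (W k * ‖w‖ ^ 2) := by
  rw [sum_apply_pair hk0 hk hnk (fun κ z => W κ * ‖z‖ ^ 2) (fun _ => by simp) w, EuclideanSpace.norm_conjVec, hW]
  ring


end Residual

/-! ## Small arithmetic facts for the packet cost -/

section Cost

/-- The phase factors `1`, `i` of a packet and its quarter-turn have modulus one. [folklore] -/
theorem norm_phase (b : Bool) : ‖(if b then (1 : ℂ) else I)‖ = 1 := by
  cases b <;> simp

/-- `‖v/2‖² = ‖v‖²/4`. [folklore] -/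
theorem norm_sq_half_smul (v : EuclideanSpace ℂ (Fin 3)) : ‖(2⁻¹ : ℂ) • v‖ ^ 2 = ‖v‖ ^ 2 / 4 := by
  rw [norm_smul, norm_inv, Complex.norm_ofNat]; ring

/-- **The enstrophy cost of one packet**: with `|k|² ≤ 2`, `‖x‖² ≤ 4/P³`, `|k+q|² ≤ P`, `‖y‖² ≤ (t/4) P⁴/16`
and `t ≤ 2r` (`P ≥ 1`), `2|k|²‖x‖² + 2|k+q|²‖y‖² ≤ 16/P³ + P⁵ r/16`. [folklore] -/
theorem packet_cost {κ κ' a b P t r : ℝ} (hP : 1 ≤ P) (ha0 : 0 ≤ a) (hb0 : 0 ≤ b) (hκ : κ ≤ 2)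
    (ha : a ≤ 4 / P ^ 3) (hκ' : κ' ≤ P) (hb : b ≤ t / 4 * P ^ 4 / 16) (ht : t ≤ 2 * r) :
    2 * (κ * a) + 2 * (κ' * b) ≤ 16 * (P ^ 3)⁻¹ + P ^ 5 * r / 16 := by
  have hP0 : 0 < P := by linarith
  have h1 : κ * a ≤ 2 * (4 / P ^ 3) := mul_le_mul hκ ha ha0 (by norm_num)
  have h2 : κ' * b ≤ P * (t / 4 * P ^ 4 / 16) := mul_le_mul hκ' hb hb0 hP0.le
  have h4 : t / 4 * P ^ 4 / 16 ≤ (2 * r) / 4 * P ^ 4 / 16 := by gcongr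
  have h5 := mul_le_mul_of_nonneg_left h4 hP0.le
  calc 2 * (κ * a) + 2 * (κ' * b) ≤ 2 * (2 * (4 / P ^ 3)) + 2 * (P * ((2 * r) / 4 * P ^ 4 / 16)) := by linarith
    _ = 16 * (P ^ 3)⁻¹ + P ^ 5 * r / 16 := by ring

end Cost

/-- **Registered sub-goal `balancedMenu_resummation` of stub S5 `stub_balancedMenu`** (summary of this
file): the mode-by-mode resummation of the half-served mode pairs of a conjugate-symmetric family.
[folklore] -/
theorem balancedMenu_resummation : ∀ (S : Finset (Fin 3 → ℤ)) (T : (Fin 3 → ℤ) → EuclideanSpace ℂ (Fin 3)) (κ : Fin 3 → ℤ), (∀ k ∈ S, -k ∈ S) → Torus.IsConjSymm T → κ ∈ S → ∑ q ∈ S, (Pi.single q ((2⁻¹ : ℂ) • T q) + Pi.single (-q) (EuclideanSpace.conjVec ((2⁻¹ : ℂ) • T q)) : (Fin 3 → ℤ) → EuclideanSpace ℂ (Fin 3)) κ = T κ :=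
  fun _ _ _ hS hT hκ => sum_pair_half_apply hS hT hκ

end Summit.AnomalousDissipation.AnomalousDissipation.Theorems.MomentParityCubicParityLoud

end
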